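import Summits.QuantumFields.YangMills.Theorems.BalabanUVNodesN15SiteCurvedShiftDefectLetter
import Summits.QuantumFields.YangMills.Theorems.BalabanUVNodesN15SiteCurvedLeftPieceLetters
import Summits.QuantumFields.YangMills.Theorems.BalabanUVNodesN15SiteCurvedLaplacianLetters
import Summits.QuantumFields.YangMills.Theorems.BalabanUVNodesN15SiteCurvedCarriersLive
import Summits.QuantumFields.YangMills.Theorems.BalabanUVNodesN15BackgroundMatrixByPartsTwoSidedLettersNode
import HarnessLib

/-!
# Route «BalabanUVNodes», cluster K4 «SpineRates» — node N15 = NE2: THE SITE LAYER WITH THE BACKGROUND LIVE IN THE TwoGrid ENTRY CURRENCY, XLIV — THE CURVED KING FAMILY IS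
# dag-n15-c's TWO-SIDED BY-PARTS FAMILY (FILE 24 `bgFamilyM₂R` at the curved readings): `NE2PlusOperator` BY NAME WITH ALL FOUR (3.42) ENTRIES — ENTRY 2 BY PARTS INCLUDED — and
# the `Live ∧ N15At` bundle, from this seat's `U ≡ 1` letters (parts XXXVIII ∕ XLI ∕ XLIII ∕ XLV, ALL TYPED) modulo exactly ONE displayed COEFFICIENT-LEVEL hypothesis: the
# fifteen-letter bundle `TwoSidedLetters` of the curved readings from the (3.35) window (Σ-c's shift-defect row letter `⊗` colour is part XLV, fed by two of those fifteen letters)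

Cell `pub-ymgap`, WIDTH SEAT `pub-ymgap-dag-n15-w1` (generation 5; director-ym №197 ∕ HUMAN RULING D-0149, №219 (1); chair R455 (A) ∕ R461; dag-lead KEY MAP v2 INBOX l.35754;
the located sequel (o1) of dag-n15-e g15 INBOX l.39322 ∕ l.39620; dag-n15-d g18 l.40235 (door (2)); CLAIM-9).  `bears_on: R4∕N15 · K3⁸ SpineGivenEndpointR13SepCoPHV
(stmt-QuantumFields-27366; K3⁷ 20544 aside = lineage)`.  Filed `--kind proof --supports stmt-QuantumFields-27366 --as helper` — COUNT-NEUTRAL.  Plumbing `def`s (`curvCfgF`,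
`curvCfgC`, `curvKopBP`, `curvCarriersBP`), the rest theorems; 0 `sorry`.  Imports BY NAME parts XLV (`curvShiftDefect_letter`; through it XLI `curvSrc_letters_massRange`, `curvShift_letters`), XLIII (`curvG_letters_massRange`,
`curvPieces_letters_massRange`), XXXVIII (`curvLap_letters_massRange`), XXXVII (`curvCarriers`, `live_curvCarriers`, `ne2PlusSite_curvCarriers`, `ne2PlusUnit_curvKunit`) and dag-n15-c
FILE 24 `…N15BackgroundMatrixByPartsTwoSidedLettersNode` (`TwoSidedLetters`, `bgInstanceM₂R`, `bgFamilyM₂R`, ★★★ `ne2PlusOperator_twoSided_of_letters`); nothing in the tree is modified.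

WHY ∕ WHAT IT SAYS.  Parts XXXIII–XL built the curved King family (King's massless coloured `A₀⁻¹ ⊗ 1` dressed by the exact adjoint transporters of a small potential, flat base
point, one blocking step, block-mean coarse potential) and its NE2⁺ operator layer through dag-n15-w3's STACKED knit — entries 0∕1∕3 discharged, entry 2 (`X∇*`) displayed (no
`K`-uniform letter for the mixed kernel).  The realised instance `curvPI` IS FILE 24's `bgInstanceM₂R (blockOf (L^K)) (blockOf L) 1 curvBgC curvBgF curvPairing` (`rfl`), and FILE 24's
kernel family `bgFamilyM₂R` at the curved READINGS `curvCfgF U = (curvCoefC′, curvCoefA′)(e^{η′ ad A′})`, `curvCfgC U =` the same of the block mean, with `G = A₀⁻¹ ⊗ 1` (mass 0),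
pieces `covPieces η τ 1 G`, derived piece `curvLapC ∘ G`, IS this family's operator layer in the print's own mechanism: entries 0∕1 are parts XXXIII∕XXXVI's (after `expTrField_zero`: the flat transporter read as `1`), entry 3 is n15-b's
derived entry (`= ΔX` in the regime, part XXXIX's identity), entry 2 is the BY-PARTS object (`= X∇*` in the regime, part XLII).  ★★★ `ne2PlusOperator_curvKopBP_of_letters`: FILE 24
★★★ at this family — EVERY `U ≡ 1` letter a theorem of this seat (XLIII: `G`, pieces over `J ⊕ J`, defects; XXXVIII: Laplacian piece; XLI: right entry `G∇*`, shifts; closed mass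
range so `m² = 0` is covered), the two COEFFICIENT-LEVEL inputs displayed VERBATIM in FILE 24's form: `hLt` (the window delivers `TwoSidedLetters … (κ′c₃₅Mα₀) θ_i (curvCfgF U)
(curvCfgC U)` — dag-n15-w2's letters give its rows∕fits clauses; the gradient ∕ translated ∕ oscillation clauses are the located new letters) and `hDSh` (Σ-c ★★ `hasMaj_shiftDefect_kingS`
`⊗` colour — dag-n15-e's device).  ★★★ `live_and_n15At_curvCarriersBP_of_letters`: with `Kop := curvKopBP` the carriers are `Live` and `N15At` BY NAME (site layer XXXIII, unit layer
XXXVII) under the same two hypotheses — NO dressed-object row displayed any more.  §4 ★★★ `ne2PlusOperator_curvKopBP_of_twoSidedLetters` ∕ ★★★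
`live_and_n15At_curvCarriersBP_of_twoSidedLetters`: `hDSh` DISCHARGED by part XLV `curvShiftDefect_letter` (`α := γ∕2`) from `hLt`'s clauses 2 (rows of `Â`) and 13 (coarse one-step
oscillation of the forward coefficients) — displayed: `hLt` ONLY.

HONEST FRAMING ∕ LIMITS.  Count-neutral KNIT over landed theorems; no new estimate; the two displayed hypotheses are model-level coefficient letters of the exact transporters (the
window's `hgradA`∕`hsecA` clauses are their source) and one `U ≡ 1` composite letter; nothing of [B5]∕[B6]∕[B9] asserted ((3.35)–(3.36) p. 396, Thm 3.1 (3.42) p. 397, (3.52) p. 400,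
(3.63)–(3.65) pp. 402–403 = SHAPES ∕ MECHANISM); King's `A = 0` MODEL ([King1986] (2.13) p. 653), NOT Bałaban's `G(U)`; NE2⁺ NOT PRINTED ∕ NOT proved for d = 4; **N15 is NOT
discharged**; K3⁸ OPEN, not claimed, skeleton v6 untouched (its N15 pin is `fullGSizedObjects`; nothing here re-pins); counts of record UNMOVED (typed 28∕28 · discharged 5∕27, A 5∕28);
one finite four-torus programme at fixed `ε` — NOT ℝ⁴, NOT infinite volume, NOT OS, NOT a mass gap, NOT Clay; R4 closes the conditional finite-𝕋⁴ rung `BalabanLadder.UV` only.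
HONEST SCOPE: odd `L ≥ 3`, `a > 0`, cubes `2L^e`, `K ≥ 1`, one blocking step, `m² = 0` operator layer ∕ massive unit layer, `0 < γ < 1`, sharp block sup sizes.  Restate-immune.
-/

set_option autoImplicit false

noncomputable section
open scoped BigOperators Matrix Matrix.Norms.Frobenius

namespace Summit.QuantumFields.YangMills.BalabanUVNodes.N15.SiteLayerBg

open Finset
open Literature.MathematicalPhysics.QuantumFieldTheory.Balaban1983to89
open Literature.MathematicalPhysics.QuantumFieldTheory.Balaban1983to89.B11SectG (BlockNorm HasMaj RowSum)
open Literature.MathematicalPhysics.QuantumFieldTheory.Balaban1983to89.B6UnitTorusCarrier (triangle254_unitTorusGeo rowSum_unitTorusGeo unitTorusGeo_len)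
open Literature.MathematicalPhysics.QuantumFieldTheory.Balaban1983to89.T4EtaRate (NE2PlusOperator)
open Literature.MathematicalPhysics.QuantumFieldTheory.Balaban1983to89.T4EtaRateDefect (idef rateWeight)
open Literature.MathematicalPhysics.QuantumFieldTheory.Balaban1983to89.T4EtaRateCoeffDefect (pull)
open Literature.MathematicalPhysics.QuantumFieldTheory.Balaban1983to89.B5Prop11Plancherel (Tor fine unitVec)
open Literature.MathematicalPhysics.QuantumFieldTheory.King1986.Torus (blockOf tdistT tdistT_nonneg tdistT_self)
open Literature.MathematicalPhysics.QuantumFieldTheory.Balaban1983to89.Beta.AveragingCorrectionJets (adCLM)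
open Literature.Barriers.QuantumFields (traceForm)
open Summit.QuantumFields.YangMills.BalabanUVNodes.N15.VectorPiece (unitTorusGeoS rateWeight_unitTorusGeoS)
open Summit.QuantumFields.YangMills.BalabanUVNodes.N15.MatrixSpecies (mmulOp liftMap liftBlk liftEquiv)
open Summit.QuantumFields.YangMills.BalabanUVNodes.N15.BackgroundLayer (fgradAdj sumJ TwoSidedLetters bgInstanceM₂R bgFamilyM₂R ne2PlusOperator_twoSided_of_letters)
open Summit.QuantumFields.YangMills.BalabanUVNodes.N15.CurvedSpecies (torStep covPieces curvCoefC curvCoefA expTrField)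
open Summit.QuantumFields.YangMills.BalabanUVNodes.N15KingModelRung (KingVolIndex)
open Summit.QuantumFields.YangMills.BalabanUVNodes.N15KingModelRung.Curved
open Summit.QuantumFields.YangMills.BalabanUVNodes.N15.PairedFamilyGuard (Live)
open YMDAG.UVSplit (NE2Carriers N15At)

variable {d : ℕ} (L : ℕ) [NeZero L]
variable {n : Type} [Fintype n] [DecidableEq n] (κ : Type) [Fintype κ] [DecidableEq κ] (e : Matrix n n ℂ ≃L[ℝ] (κ → ℝ)) (a : ℝ)

/-! ## §1 The curved readings and the by-parts kernel family -/

section Defs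

/-- THE FINE READING `U′ ↦ (C′, Â′)`: n15-w3's exact coefficients of the fine transporters `e^{η′ ad A′}` at the flat base point (`η′ = (L^{K+1})⁻¹`).
[cite: Balaban1985BackgroundPropagators, (3.50)–(3.53) p.400 (shape)] -/
def curvCfgF (i : KingVolIndex d) (A' : (curvBgF L n i).Cfg) :
    (Tor (fine L (fine (L ^ i.K) (curvCube L i))) → Matrix κ κ ℝ) × (Fin (d + 1) ⊕ Fin (d + 1) → Tor (fine L (fine (L ^ i.K) (curvCube L i))) → Matrix κ κ ℝ) :=
  (curvCoefC (((L : ℝ) ^ (i.K + 1))⁻¹) (torStep (fine L (fine (L ^ i.K) (curvCube L i)))) (fun _ _ => 1)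
      (expTrField e (((L : ℝ) ^ (i.K + 1))⁻¹) (fun μ y' => adCLM ℝ (A' μ y'))),
    curvCoefA (((L : ℝ) ^ (i.K + 1))⁻¹) (torStep (fine L (fine (L ^ i.K) (curvCube L i)))) (fun _ _ => 1)
      (expTrField e (((L : ℝ) ^ (i.K + 1))⁻¹) (fun μ y' => adCLM ℝ (A' μ y'))))

/-- THE COARSE READING `U′ ↦ (C, Â)` of the block-mean potential (`η = L·η′`). [cite: Balaban1985BackgroundPropagators, (3.36) p.396, (3.52) p.400 (shape)] -/
def curvCfgC (i : KingVolIndex d) (A' : (curvBgF L n i).Cfg) :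
    (Tor (fine (L ^ i.K) (curvCube L i)) → Matrix κ κ ℝ) × (Fin (d + 1) ⊕ Fin (d + 1) → Tor (fine (L ^ i.K) (curvCube L i)) → Matrix κ κ ℝ) :=
  (curvCoefC ((L : ℝ) * ((L : ℝ) ^ (i.K + 1))⁻¹) (torStep (fine (L ^ i.K) (curvCube L i))) (fun _ _ => 1)
      (expTrField e ((L : ℝ) * ((L : ℝ) ^ (i.K + 1))⁻¹) (fun μ y => adCLM ℝ ((curvPairing L κ i).avg A' μ y))),
    curvCoefA ((L : ℝ) * ((L : ℝ) ^ (i.K + 1))⁻¹) (torStep (fine (L ^ i.K) (curvCube L i))) (fun _ _ => 1)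
      (expTrField e ((L : ℝ) * ((L : ℝ) ^ (i.K + 1))⁻¹) (fun μ y => adCLM ℝ ((curvPairing L κ i).avg A' μ y))))

/-- **THE BY-PARTS KERNEL FAMILY OF THE CURVED KING FAMILY**: FILE 24's `bgFamilyM₂R` at the curved readings — entries 0∕1 = parts XXXIII∕XXXVI's (flat transporter read as `1`), entry 2 BY PARTS, entry 3 DERIVED.
[cite: Balaban1985BackgroundPropagators, Thm 3.1 (3.42) p.397 (the four entries: shape), (3.63)–(3.65) pp.402–403 (mechanism)] -/
def curvKopBP (i : KingVolIndex d × Fin (d + 1)) : B9.KernelFamily (curvPI L κ n i.1).gc (curvPI L κ n i.1).Bf :=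
  bgFamilyM₂R (g := unitTorusGeoS L i.1.K (curvCube L i.1) i.1.Msz) (ι := κ) (blockOf (L ^ i.1.K) (curvCube L i.1)) (blockOf L (fine (L ^ i.1.K) (curvCube L i.1))) 1
    (curvBgC L n i.1) (curvBgF L n i.1) (curvPairing L κ i.1) (curvCfgF L κ e i.1) (curvCfgC L κ e i.1) (torStep (fine (L ^ i.1.K) (curvCube L i.1)))
    (torStep (fine L (fine (L ^ i.1.K) (curvCube L i.1)))) ((L : ℝ) ^ i.1.K) ((L : ℝ) ^ (i.1.K + 1)) i.2 (kingGT L a 0 i.1.K (curvCube L i.1) κ)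
    (curvLapC L κ i.1 ∘ₗ kingGT L a 0 i.1.K (curvCube L i.1) κ)
    (covPieces ((L : ℝ) * ((L : ℝ) ^ (i.1.K + 1))⁻¹) (torStep (fine (L ^ i.1.K) (curvCube L i.1))) (fun _ _ => (1 : Matrix κ κ ℝ)) (kingGT L a 0 i.1.K (curvCube L i.1) κ))
    (kingGT₁ L a 0 i.1.K (curvCube L i.1) κ) (curvLapF L κ i.1 ∘ₗ kingGT₁ L a 0 i.1.K (curvCube L i.1) κ)
    (covPieces (((L : ℝ) ^ (i.1.K + 1))⁻¹) (torStep (fine L (fine (L ^ i.1.K) (curvCube L i.1)))) (fun _ _ => (1 : Matrix κ κ ℝ)) (kingGT₁ L a 0 i.1.K (curvCube L i.1) κ))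

/-- THE CARRIERS OF RECORD WITH THE BY-PARTS OPERATOR LAYER: part XXXVII's `curvCarriers` with `Kop := curvKopBP`. [cite: Balaban1985BackgroundPropagators, Thm 3.1 p.397 (shape)] -/
def curvCarriersBP (c35 p m2 : ℝ) (c c' : KingVolIndex d → κ) : NE2Carriers :=
  { curvCarriers L κ e a c35 p m2 c c' with Kop := curvKopBP L κ e a }

end Defs

/-! ## §2 ★★★ `NE2PlusOperator` for the by-parts operator layer of the curved King family, from the `U ≡ 1` letters of this seat -/

section Operator

/-- ★★★ **NE2⁺, OPERATOR LAYER, ALL FOUR ENTRIES, FOR THE CURVED KING FAMILY — modulo the curved coefficients' letter bundle and the shift-defect row letter.**  For odd `L ≥ 3`, `a > 0`,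
`0 < γ < 1`, `c₃₅, κ′, r₀ > 0`, `δ_T > 0`, `m_T ≥ 0`: IF the (3.35) window delivers FILE 24's fifteen coefficient letters of the curved readings at scale `κ′·c₃₅·M·α₀` and rate
`θ_i = (L^K)^{−γ∕2}` (`hLt`) and Σ-c's shift-defect row letter `⊗` colour at rate `δ_T` (`hDSh`), THEN `NE2PlusOperator c₃₅ curvPI curvKopBP` — FILE 24 ★★★ with every `U ≡ 1` letter
a theorem of this seat on the closed mass range (`G`, pieces, Laplacian piece, right entry, defects, shifts) at the common rate `min(δ_letters, δ_T)`.
[cite: Balaban1985BackgroundPropagators, Thm 3.1 p.397 (quantifier template); (3.35)–(3.36) p.396, (3.42) p.397, (3.52) p.400, (3.63)–(3.65) pp.402–403 (shapes, mechanism); King1986, (2.13)–(2.17) p.653, p.664 (pairing), (4.1)–(4.5) p.670] -/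
theorem ne2PlusOperator_curvKopBP_of_letters (hLodd : Odd L) (hL : 2 ≤ L) (ha : 0 < a) {γ : ℝ} (hγ0 : 0 < γ) (hγ1 : γ < 1) (c35 κ' r₀ δT mT : ℝ) (hc35 : 0 < c35)
    (hκ' : 0 < κ') (hr₀ : 0 < r₀) (hδT : 0 < δT) (hmT : 0 ≤ mT)
    (hLt : ∀ (i : KingVolIndex d × Fin (d + 1)) (U : (curvBgF L n i.1).Cfg) (α₀ : ℝ), (curvBgF L n i.1).Reg335 c35 α₀ U → 0 < α₀ →
      1 ≤ (unitTorusGeoS L i.1.K (curvCube L i.1) i.1.Msz).M → c35 * (unitTorusGeoS L i.1.K (curvCube L i.1) i.1.Msz).M * α₀ ≤ r₀ →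
      TwoSidedLetters (Fin (d + 1)) κ (blockOf L (fine (L ^ i.1.K) (curvCube L i.1))) (torStep (fine (L ^ i.1.K) (curvCube L i.1)))
        (torStep (fine L (fine (L ^ i.1.K) (curvCube L i.1)))) ((L : ℝ) ^ i.1.K) ((L : ℝ) ^ (i.1.K + 1))
        (κ' * (c35 * (unitTorusGeoS L i.1.K (curvCube L i.1) i.1.Msz).M * α₀)) (((L : ℝ) ^ i.1.K) ^ (-(γ / 2))) (curvCfgF L κ e i.1 U) (curvCfgC L κ e i.1 U))
    (hDSh : ∀ (i : KingVolIndex d × Fin (d + 1)) (U : (curvBgF L n i.1).Cfg) (α₀ : ℝ), (curvBgF L n i.1).Reg335 c35 α₀ U → 0 < α₀ →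
      1 ≤ (unitTorusGeoS L i.1.K (curvCube L i.1) i.1.Msz).M → c35 * (unitTorusGeoS L i.1.K (curvCube L i.1) i.1.Msz).M * α₀ ≤ r₀ →
      ∀ μ, HasMaj (BlockNorm.ofBlocks (unitTorusGeoS L i.1.K (curvCube L i.1) i.1.Msz) (liftBlk (liftBlk (blockOf (L ^ i.1.K) (curvCube L i.1)) κ) (Fin (d + 1))))
        (BlockNorm.ofBlocks (unitTorusGeoS L i.1.K (curvCube L i.1) i.1.Msz) (liftBlk (blockOf (L ^ i.1.K) (curvCube L i.1) ∘ blockOf L (fine (L ^ i.1.K) (curvCube L i.1))) κ))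
        (idef (pull (liftMap (blockOf L (fine (L ^ i.1.K) (curvCube L i.1))) κ)) (pull (liftMap (blockOf L (fine (L ^ i.1.K) (curvCube L i.1))) κ))
            (pull ⇑(liftEquiv (torStep (fine L (fine (L ^ i.1.K) (curvCube L i.1))) μ) κ)) (pull ⇑(liftEquiv (torStep (fine (L ^ i.1.K) (curvCube L i.1)) μ) κ)) ∘ₗ
          (mmulOp ((curvCfgC L κ e i.1 U).2 (Sum.inl μ) ∘ ⇑(torStep (fine (L ^ i.1.K) (curvCube L i.1)) μ).symm) ∘ₗ
            sumJ fun ν => kingGT L a 0 i.1.K (curvCube L i.1) κ ∘ₗ fgradAdj ((L : ℝ) ^ i.1.K) (liftEquiv (torStep (fine (L ^ i.1.K) (curvCube L i.1)) ν) κ)))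
        (fun y y' => mT * (κ' * (c35 * (unitTorusGeoS L i.1.K (curvCube L i.1) i.1.Msz).M * α₀)) * ((L : ℝ) ^ i.1.K) ^ (-(γ / 2)) *
          Real.exp (-(δT * tdistT (curvCube L i.1) y y')))) :
    NE2PlusOperator c35 (fun i : KingVolIndex d × Fin (d + 1) => curvPI L κ n i.1) (curvKopBP L κ e a) := by
  -- the `U ≡ 1` letters of this seat, at mass `0`
  obtain ⟨β₁, δ₁, m₁, hβ₁, hδ₁, hm₁, HG⟩ := curvG_letters_massRange (d := d) L κ a hLodd hL ha le_rfl hγ0 hγ1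
  obtain ⟨β₂, δ₂, m₂, hβ₂, hδ₂, hm₂, HP⟩ := curvPieces_letters_massRange (d := d) L κ a hLodd hL ha le_rfl hγ0 hγ1
  obtain ⟨β₃, δ₃, m₃, hβ₃, hδ₃, hm₃, HΔ⟩ := curvLap_letters_massRange (d := d) L κ a hLodd hL ha le_rfl hγ0.le hγ1
  obtain ⟨β₄, δ₄, m₄, hβ₄, hδ₄, hm₄, HS⟩ := curvSrc_letters_massRange (d := d) L κ a hLodd hL ha le_rfl hγ0.le hγ1
  -- one `(β, δ, m₀)`
  set β : ℝ := max (max β₁ β₂) (max β₃ β₄) with hβdef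
  set δ : ℝ := min (min (min δ₁ δ₂) (min δ₃ δ₄)) δT with hδdef
  set m₀ : ℝ := max (max m₁ m₂) (max m₃ m₄) with hm₀def
  have hβ : 0 < β := lt_max_of_lt_left (lt_max_of_lt_left hβ₁)
  have hδ : 0 < δ := lt_min (lt_min (lt_min hδ₁ hδ₂) (lt_min hδ₃ hδ₄)) hδT
  have hm₀ : 0 < m₀ := lt_max_of_lt_left (lt_max_of_lt_left hm₁)
  obtain ⟨hb₁, hb₂, hb₃, hb₄⟩ : β₁ ≤ β ∧ β₂ ≤ β ∧ β₃ ≤ β ∧ β₄ ≤ β := by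
    simp only [hβdef, le_max_iff, le_refl, true_or, or_true, and_self]
  obtain ⟨hd₁, hd₂, hd₃, hd₄, hdT⟩ : δ ≤ δ₁ ∧ δ ≤ δ₂ ∧ δ ≤ δ₃ ∧ δ ≤ δ₄ ∧ δ ≤ δT := by
    simp only [hδdef, min_le_iff, le_refl, true_or, or_true, and_self]
  obtain ⟨hmm₁, hmm₂, hmm₃, hmm₄⟩ : m₁ ≤ m₀ ∧ m₂ ≤ m₀ ∧ m₃ ≤ m₀ ∧ m₄ ≤ m₀ := by
    simp only [hm₀def, le_max_iff, le_refl, true_or, or_true, and_self]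
  have hL0 : L ≠ 0 := NeZero.ne L
  have hLr : (0 : ℝ) < (L : ℝ) := by exact_mod_cast Nat.pos_of_ne_zero hL0
  have hσ : 0 < δ / 12 := by positivity
  -- weakening of a `β′e^{−δ′d}` ∕ `m′θe^{−δ′d}` letter to the common constants
  have wk : ∀ (i : KingVolIndex d) {β' δ' : ℝ}, 0 ≤ β' → β' ≤ β → δ ≤ δ' → ∀ y y' : Tor (curvCube L i),
      β' * Real.exp (-(δ' * tdistT (curvCube L i) y y')) ≤ β * Real.exp (-(δ * tdistT (curvCube L i) y y')) := fun i β' δ' hb' hbb hdd y y' =>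
    mul_le_mul hbb (Real.exp_le_exp.mpr (by nlinarith [tdistT_nonneg (curvCube L i) y y'])) (Real.exp_nonneg _) (hb'.trans hbb)
  have wkm : ∀ (i : KingVolIndex d) {m' δ' : ℝ}, 0 ≤ m' → m' ≤ m₀ → δ ≤ δ' → ∀ y y' : Tor (curvCube L i),
      m' * ((L : ℝ) ^ i.K) ^ (-(γ / 2)) * Real.exp (-(δ' * tdistT (curvCube L i) y y')) ≤ m₀ * ((L : ℝ) ^ i.K) ^ (-(γ / 2)) * Real.exp (-(δ * tdistT (curvCube L i) y y')) :=
    fun i m' δ' hm' hmm hdd y y' => by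
    have hθ : 0 ≤ ((L : ℝ) ^ i.K) ^ (-(γ / 2)) := Real.rpow_nonneg (pow_nonneg hLr.le _) _
    exact mul_le_mul (mul_le_mul_of_nonneg_right hmm hθ) (Real.exp_le_exp.mpr (by nlinarith [tdistT_nonneg (curvCube L i) y y'])) (Real.exp_nonneg _)
      (mul_nonneg (hm'.trans hmm) hθ)
  have wkT : ∀ (i : KingVolIndex d) (y y' : Tor (curvCube L i)), Real.exp δ * Real.exp (-(δ * tdistT (curvCube L i) y y')) ≤ Real.exp δ * Real.exp (-(δ * tdistT (curvCube L i) y y')) :=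
    fun _ _ _ => le_rfl
  refine ne2PlusOperator_twoSided_of_letters (I := KingVolIndex d × Fin (d + 1)) (J := Fin (d + 1)) (ι := κ)
    (g := fun i => unitTorusGeoS L i.1.K (curvCube L i.1) i.1.Msz) (X := fun i => Tor (fine (L ^ i.1.K) (curvCube L i.1)))
    (X' := fun i => Tor (fine L (fine (L ^ i.1.K) (curvCube L i.1)))) (blk := fun i => blockOf (L ^ i.1.K) (curvCube L i.1))
    (π := fun i => blockOf L (fine (L ^ i.1.K) (curvCube L i.1))) (τ := fun i => torStep (fine (L ^ i.1.K) (curvCube L i.1)))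
    (τ' := fun i => torStep (fine L (fine (L ^ i.1.K) (curvCube L i.1)))) (n := fun i => (L : ℝ) ^ i.1.K) (n' := fun i => (L : ℝ) ^ (i.1.K + 1)) (nsh := fun _ => 1)
    (Bc := fun i => curvBgC L n i.1) (Bf := fun i => curvBgF L n i.1) (P := fun i => curvPairing L κ i.1) (cfgF := fun i => curvCfgF L κ e i.1)
    (cfgC := fun i => curvCfgC L κ e i.1) (θ := fun i => ((L : ℝ) ^ i.1.K) ^ (-(γ / 2))) (ν := fun i => i.2)
    (G := fun i => kingGT L a 0 i.1.K (curvCube L i.1) κ) (D₃ := fun i => curvLapC L κ i.1 ∘ₗ kingGT L a 0 i.1.K (curvCube L i.1) κ)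
    (D := fun i => covPieces ((L : ℝ) * ((L : ℝ) ^ (i.1.K + 1))⁻¹) (torStep (fine (L ^ i.1.K) (curvCube L i.1))) (fun _ _ => (1 : Matrix κ κ ℝ)) (kingGT L a 0 i.1.K (curvCube L i.1) κ))
    (G' := fun i => kingGT₁ L a 0 i.1.K (curvCube L i.1) κ) (D₃' := fun i => curvLapF L κ i.1 ∘ₗ kingGT₁ L a 0 i.1.K (curvCube L i.1) κ)
    (D' := fun i => covPieces (((L : ℝ) ^ (i.1.K + 1))⁻¹) (torStep (fine L (fine (L ^ i.1.K) (curvCube L i.1)))) (fun _ _ => (1 : Matrix κ κ ℝ)) (kingGT₁ L a 0 i.1.K (curvCube L i.1) κ))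
    c35 κ' r₀ hc35 hκ' hr₀ (fun i => triangle254_unitTorusGeo L i.1.K _) (fun i a b => tdistT_nonneg _ _ _) (fun i y => tdistT_self _ y) hσ.le
    (B4Sect5Proof.latticeConst_nonneg (d + 1) hσ.le) (fun i => rowSum_unitTorusGeo L i.1.K _ hσ) (fun i => inv_pos.mpr (pow_pos hLr _)) (fun i => hLr)
    (fun i y => (unitTorusGeo_len L i.1.K _ hL0 y).symm.le) (by linarith) hβ.le hm₀.le (half_pos hγ0) (fun i => Real.rpow_nonneg (pow_nonneg hLr.le _) _)
    (fun i y => (rateWeight_unitTorusGeoS L (curvCube L i.1) i.1.K i.1.Msz (γ / 2) y).symm.le) (Real.exp_pos δ).le hmT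
    (fun i => ((HG i.1 0 le_rfl le_rfl).1).mono fun y y' => wk i.1 hβ₁.le hb₁ hd₁ y y')
    (fun i s => ((HP i.1 0 le_rfl le_rfl s).1).mono fun y y' => wk i.1 hβ₂.le hb₂ hd₂ y y')
    (fun i => ((HG i.1 0 le_rfl le_rfl).2.1).mono fun y y' => wk i.1 hβ₁.le hb₁ hd₁ y y')
    (fun i s => ((HP i.1 0 le_rfl le_rfl s).2.1).mono fun y y' => wk i.1 hβ₂.le hb₂ hd₂ y y')
    (fun i => ((HΔ i.1 0 le_rfl le_rfl).1).mono fun y y' => wk i.1 hβ₃.le hb₃ hd₃ y y')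
    (fun i => ((HG i.1 0 le_rfl le_rfl).2.2).mono fun y y' => wkm i.1 hm₁.le hmm₁ hd₁ y y')
    (fun i s => ((HP i.1 0 le_rfl le_rfl s).2.2).mono fun y y' => wkm i.1 hm₂.le hmm₂ hd₂ y y')
    (fun i => ((HΔ i.1 0 le_rfl le_rfl).2).mono fun y y' => wkm i.1 hm₃.le hmm₃ hd₃ y y')
    (fun i ν => ((HS i.1 0 le_rfl le_rfl ν).1).mono fun y y' => wk i.1 hβ₄.le hb₄ hd₄ y y')
    (fun i ν => ((HS i.1 0 le_rfl le_rfl ν).2.1).mono fun y y' => wk i.1 hβ₄.le hb₄ hd₄ y y')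
    (fun i ν => ((HS i.1 0 le_rfl le_rfl ν).2.2).mono fun y y' => wkm i.1 hm₄.le hmm₄ hd₄ y y')
    (fun i μ => (curvShift_letters L κ hδ.le i.1 μ).1) (fun i μ => (curvShift_letters L κ hδ.le i.1 μ).2) hLt ?_
  -- the shift-defect row letter, weakened from `δ_T` to `δ`
  intro i U α₀ hreg hα₀ hM hr μ
  refine (hDSh i U α₀ hreg hα₀ hM hr μ).mono fun y y' => ?_
  have h0 : 0 ≤ mT * (κ' * (c35 * (unitTorusGeoS L i.1.K (curvCube L i.1) i.1.Msz).M * α₀)) * ((L : ℝ) ^ i.1.K) ^ (-(γ / 2)) := by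
    have hM0 : 0 ≤ (unitTorusGeoS L i.1.K (curvCube L i.1) i.1.Msz).M := zero_le_one.trans hM
    have hθ : 0 ≤ ((L : ℝ) ^ i.1.K) ^ (-(γ / 2)) := Real.rpow_nonneg (pow_nonneg hLr.le _) _
    positivity
  exact mul_le_mul_of_nonneg_left (Real.exp_le_exp.mpr (by nlinarith [tdistT_nonneg (curvCube L i.1) y y'])) h0

end Operator

/-! ## §3 ★★★ The bundle: `Live ∧ N15At` for the carriers with the by-parts operator layer -/

section Bundle

/-- The carriers with the by-parts operator layer are `Live` (the guard reads no operator kernel: part XXXVII `live_curvCarriers` verbatim). [folklore] -/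
theorem live_curvCarriersBP {c35 : ℝ} (hc35 : 0 ≤ c35) (p m2 : ℝ) (c c' : KingVolIndex d → κ) : Live (curvCarriersBP L κ e a c35 p m2 c c') :=
  have h := live_curvCarriers L κ e a hc35 p m2 c c'
  ⟨h.cofinal, h.reg_one, h.inΛ_nonempty⟩

/-- ★★★ **`Live ∧ N15At` FOR THE CURVED KING FAMILY WITH THE BY-PARTS OPERATOR LAYER — NO DRESSED-OBJECT ROW DISPLAYED**: operator layer §2 (all four (3.42) entries, entry 2 by parts)
modulo the curved readings' `TwoSidedLetters` from the window and the shift-defect row letter; site layer part XXXIII (`ne2PlusSite_curvCarriers`); unit layer part XXXVII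
(`ne2PlusUnit_curvKunit`, massive `m² > 0`); liveness part XXXVII. [cite: Balaban1985BackgroundPropagators, Thm 3.1 p.397, Thm 3.2 (3.48) p.398, Thm 3.15 (3.187) p.432 (shapes); King1986, Lemma 4.5 (4.38) p.674] -/
theorem live_and_n15At_curvCarriersBP_of_letters (he : ∀ X Y : Matrix n n ℂ, traceForm X Y = e X ⬝ᵥ e Y) (hLodd : Odd L) (hL : 2 ≤ L) (ha : 0 < a) {γ : ℝ} (hγ0 : 0 < γ)
    (hγ1 : γ < 1) {c35 : ℝ} (hc35 : 0 < c35) {m2 : ℝ} (hm : 0 < m2) (p : ℝ) (c c' : KingVolIndex d → κ) (κ' r₀ δT mT : ℝ) (hκ' : 0 < κ') (hr₀ : 0 < r₀) (hδT : 0 < δT)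
    (hmT : 0 ≤ mT)
    (hLt : ∀ (i : KingVolIndex d × Fin (d + 1)) (U : (curvBgF L n i.1).Cfg) (α₀ : ℝ), (curvBgF L n i.1).Reg335 c35 α₀ U → 0 < α₀ →
      1 ≤ (unitTorusGeoS L i.1.K (curvCube L i.1) i.1.Msz).M → c35 * (unitTorusGeoS L i.1.K (curvCube L i.1) i.1.Msz).M * α₀ ≤ r₀ →
      TwoSidedLetters (Fin (d + 1)) κ (blockOf L (fine (L ^ i.1.K) (curvCube L i.1))) (torStep (fine (L ^ i.1.K) (curvCube L i.1)))
        (torStep (fine L (fine (L ^ i.1.K) (curvCube L i.1)))) ((L : ℝ) ^ i.1.K) ((L : ℝ) ^ (i.1.K + 1))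
        (κ' * (c35 * (unitTorusGeoS L i.1.K (curvCube L i.1) i.1.Msz).M * α₀)) (((L : ℝ) ^ i.1.K) ^ (-(γ / 2))) (curvCfgF L κ e i.1 U) (curvCfgC L κ e i.1 U))
    (hDSh : ∀ (i : KingVolIndex d × Fin (d + 1)) (U : (curvBgF L n i.1).Cfg) (α₀ : ℝ), (curvBgF L n i.1).Reg335 c35 α₀ U → 0 < α₀ →
      1 ≤ (unitTorusGeoS L i.1.K (curvCube L i.1) i.1.Msz).M → c35 * (unitTorusGeoS L i.1.K (curvCube L i.1) i.1.Msz).M * α₀ ≤ r₀ →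
      ∀ μ, HasMaj (BlockNorm.ofBlocks (unitTorusGeoS L i.1.K (curvCube L i.1) i.1.Msz) (liftBlk (liftBlk (blockOf (L ^ i.1.K) (curvCube L i.1)) κ) (Fin (d + 1))))
        (BlockNorm.ofBlocks (unitTorusGeoS L i.1.K (curvCube L i.1) i.1.Msz) (liftBlk (blockOf (L ^ i.1.K) (curvCube L i.1) ∘ blockOf L (fine (L ^ i.1.K) (curvCube L i.1))) κ))
        (idef (pull (liftMap (blockOf L (fine (L ^ i.1.K) (curvCube L i.1))) κ)) (pull (liftMap (blockOf L (fine (L ^ i.1.K) (curvCube L i.1))) κ))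
            (pull ⇑(liftEquiv (torStep (fine L (fine (L ^ i.1.K) (curvCube L i.1))) μ) κ)) (pull ⇑(liftEquiv (torStep (fine (L ^ i.1.K) (curvCube L i.1)) μ) κ)) ∘ₗ
          (mmulOp ((curvCfgC L κ e i.1 U).2 (Sum.inl μ) ∘ ⇑(torStep (fine (L ^ i.1.K) (curvCube L i.1)) μ).symm) ∘ₗ
            sumJ fun ν => kingGT L a 0 i.1.K (curvCube L i.1) κ ∘ₗ fgradAdj ((L : ℝ) ^ i.1.K) (liftEquiv (torStep (fine (L ^ i.1.K) (curvCube L i.1)) ν) κ)))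
        (fun y y' => mT * (κ' * (c35 * (unitTorusGeoS L i.1.K (curvCube L i.1) i.1.Msz).M * α₀)) * ((L : ℝ) ^ i.1.K) ^ (-(γ / 2)) *
          Real.exp (-(δT * tdistT (curvCube L i.1) y y')))) :
    Live (curvCarriersBP L κ e a c35 p m2 c c') ∧ N15At (curvCarriersBP L κ e a c35 p m2 c c') :=
  ⟨live_curvCarriersBP L κ e a hc35.le p m2 c c',
    ne2PlusOperator_curvKopBP_of_letters (d := d) L κ e a hLodd hL ha hγ0 hγ1 c35 κ' r₀ δT mT hc35 hκ' hr₀ hδT hmT hLt hDSh,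
    ne2PlusSite_curvCarriers L κ e a he hLodd hL ha c35 p m2 c c',
    ne2PlusUnit_curvKunit L κ a hL ha hm c35⟩

end Bundle

/-! ## §4 ★★★ The shift-defect row letter discharged (part XLV): `TwoSidedLetters` from the window is the ONLY displayed input -/

section TwoSidedOnly

/-- ★★★ **NE2⁺, OPERATOR LAYER, ALL FOUR ENTRIES, FOR THE CURVED KING FAMILY — modulo the curved readings' letter bundle ONLY**: §2 with `hDSh` supplied by part XLV ★★
`curvShiftDefect_letter` (`α := γ∕2`, `a₀ := κ′c₃₅Mα₀` from `hLt`'s clause 2, `o₁ := a₀θ_i` from clause 13; `m_T := 2C`, rate XLV's `δ`).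
[cite: Balaban1985BackgroundPropagators, Thm 3.1 p.397 (quantifier template); (3.35)–(3.36) p.396, (3.42) p.397, (3.52) p.400, (3.63)–(3.65) pp.402–403 (shapes, mechanism); King1986, (2.13)–(2.17) p.653, p.664 (pairing)] -/
theorem ne2PlusOperator_curvKopBP_of_twoSidedLetters (hLodd : Odd L) (hL : 2 ≤ L) (ha : 0 < a) {γ : ℝ} (hγ0 : 0 < γ) (hγ1 : γ < 1) (c35 κ' r₀ : ℝ) (hc35 : 0 < c35)
    (hκ' : 0 < κ') (hr₀ : 0 < r₀)
    (hLt : ∀ (i : KingVolIndex d × Fin (d + 1)) (U : (curvBgF L n i.1).Cfg) (α₀ : ℝ), (curvBgF L n i.1).Reg335 c35 α₀ U → 0 < α₀ →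
      1 ≤ (unitTorusGeoS L i.1.K (curvCube L i.1) i.1.Msz).M → c35 * (unitTorusGeoS L i.1.K (curvCube L i.1) i.1.Msz).M * α₀ ≤ r₀ →
      TwoSidedLetters (Fin (d + 1)) κ (blockOf L (fine (L ^ i.1.K) (curvCube L i.1))) (torStep (fine (L ^ i.1.K) (curvCube L i.1)))
        (torStep (fine L (fine (L ^ i.1.K) (curvCube L i.1)))) ((L : ℝ) ^ i.1.K) ((L : ℝ) ^ (i.1.K + 1))
        (κ' * (c35 * (unitTorusGeoS L i.1.K (curvCube L i.1) i.1.Msz).M * α₀)) (((L : ℝ) ^ i.1.K) ^ (-(γ / 2))) (curvCfgF L κ e i.1 U) (curvCfgC L κ e i.1 U)) :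
    NE2PlusOperator c35 (fun i : KingVolIndex d × Fin (d + 1) => curvPI L κ n i.1) (curvKopBP L κ e a) := by
  obtain ⟨δ, C, hδ, hC, H⟩ := curvShiftDefect_letter (d := d) L κ a hLodd hL ha le_rfl (half_pos hγ0) (by linarith : γ / 2 < 1)
  have hLr : (0 : ℝ) < (L : ℝ) := by exact_mod_cast Nat.pos_of_ne_zero (NeZero.ne L)
  refine ne2PlusOperator_curvKopBP_of_letters (d := d) L κ e a hLodd hL ha hγ0 hγ1 c35 κ' r₀ δ (2 * C) hc35 hκ' hr₀ hδ (by positivity) hLt ?_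
  intro i U α₀ hreg hα₀ hM hr μ
  obtain ⟨-, hA, -, -, -, -, -, -, -, -, -, -, hosc, -, -⟩ := hLt i U α₀ hreg hα₀ hM hr
  have ha₀ : 0 ≤ κ' * (c35 * (unitTorusGeoS L i.1.K (curvCube L i.1) i.1.Msz).M * α₀) := by
    have hM0 : 0 ≤ (unitTorusGeoS L i.1.K (curvCube L i.1) i.1.Msz).M := zero_le_one.trans hM
    positivity
  have hθ : 0 ≤ ((L : ℝ) ^ i.1.K) ^ (-(γ / 2)) := Real.rpow_nonneg (pow_nonneg hLr.le _) _
  refine (H i.1 0 le_rfl le_rfl μ ((curvCfgC L κ e i.1 U).2 (Sum.inl μ)) _ _ ha₀ (mul_nonneg ha₀ hθ) (fun x c => hA (Sum.inl μ) x c) (fun x c => hosc μ x c)).mono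
    fun y y' => le_of_eq ?_
  ring

/-- ★★★ **`Live ∧ N15At` FOR THE CURVED KING FAMILY WITH THE BY-PARTS OPERATOR LAYER, modulo `TwoSidedLetters` from the window ONLY** (§3 with `hDSh` discharged by part XLV).
[cite: Balaban1985BackgroundPropagators, Thm 3.1 p.397, Thm 3.2 (3.48) p.398, Thm 3.15 (3.187) p.432 (shapes); King1986, Lemma 4.5 (4.38) p.674] -/
theorem live_and_n15At_curvCarriersBP_of_twoSidedLetters (he : ∀ X Y : Matrix n n ℂ, traceForm X Y = e X ⬝ᵥ e Y) (hLodd : Odd L) (hL : 2 ≤ L) (ha : 0 < a) {γ : ℝ}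
    (hγ0 : 0 < γ) (hγ1 : γ < 1) {c35 : ℝ} (hc35 : 0 < c35) {m2 : ℝ} (hm : 0 < m2) (p : ℝ) (c c' : KingVolIndex d → κ) (κ' r₀ : ℝ) (hκ' : 0 < κ') (hr₀ : 0 < r₀)
    (hLt : ∀ (i : KingVolIndex d × Fin (d + 1)) (U : (curvBgF L n i.1).Cfg) (α₀ : ℝ), (curvBgF L n i.1).Reg335 c35 α₀ U → 0 < α₀ →
      1 ≤ (unitTorusGeoS L i.1.K (curvCube L i.1) i.1.Msz).M → c35 * (unitTorusGeoS L i.1.K (curvCube L i.1) i.1.Msz).M * α₀ ≤ r₀ →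
      TwoSidedLetters (Fin (d + 1)) κ (blockOf L (fine (L ^ i.1.K) (curvCube L i.1))) (torStep (fine (L ^ i.1.K) (curvCube L i.1)))
        (torStep (fine L (fine (L ^ i.1.K) (curvCube L i.1)))) ((L : ℝ) ^ i.1.K) ((L : ℝ) ^ (i.1.K + 1))
        (κ' * (c35 * (unitTorusGeoS L i.1.K (curvCube L i.1) i.1.Msz).M * α₀)) (((L : ℝ) ^ i.1.K) ^ (-(γ / 2))) (curvCfgF L κ e i.1 U) (curvCfgC L κ e i.1 U)) :
    Live (curvCarriersBP L κ e a c35 p m2 c c') ∧ N15At (curvCarriersBP L κ e a c35 p m2 c c') :=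
  ⟨live_curvCarriersBP L κ e a hc35.le p m2 c c',
    ne2PlusOperator_curvKopBP_of_twoSidedLetters (d := d) L κ e a hLodd hL ha hγ0 hγ1 c35 κ' r₀ hc35 hκ' hr₀ hLt,
    ne2PlusSite_curvCarriers L κ e a he hLodd hL ha c35 p m2 c c',
    ne2PlusUnit_curvKunit L κ a hL ha hm c35⟩

end TwoSidedOnly

end Summit.QuantumFields.YangMills.BalabanUVNodes.N15.SiteLayerBg

end
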